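import Literature.RingTheory.CentralSimple.PositiveInvolutionStableSubalgebra
import Mathlib.LinearAlgebra.SesquilinearForm.Basic
import HarnessLib

/-!
# An anti-involution realised as the adjoint for a non-degenerate form stabilises every subalgebra generated by
# an adjoint-closed set of operators (Knus–Merkurjev–Rost–Tignol Ch. I (∗); Mumford §21 / Milne CM Prop. 1.39)

M.-A. Knus, A. Merkurjev, M. Rost, J.-P. Tignol, *The Book of Involutions* (1998), Ch. I, introduction (pp. 1–2):
for a nonsingular bilinear form `b` on `V`, «`σ_b(f)` may be defined by the following property: (∗)
`b(x, f(y)) = b(σ_b(f)(x), y)`» — the adjoint of an operator with respect to a non-degenerate form is UNIQUE.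
D. Mumford, *Abelian Varieties* (1970), §20–§21: the Rosati involution of `End⁰(X)` defined by a polarisation is
the adjoint with respect to the Riemann form `E^L`, `E^L(φx, y) = E^L(x, φ'y)`, and it is a positive
anti-involution (§21 Thm. 1).  Application of record (the cell's instantiation `Liu2021/AppendixC/HeckeImageRosatiStable`
of Liu's App. D, proof of Thm. D.6 (1)): the image `H` of the Hecke algebra in `End⁰` of the Jacobian of a unitary
Shimura curve is Rosati-stable BECAUSE the Hecke operator
`[KgK]` has the `E`-adjoint `[Kg⁻¹K]`, again a Hecke operator — so `H = ℚ[{[KgK]}]` is stable and the block fields of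
its centre carry positive involutions (the tree's ★ `Idempotents.PositiveInvolutionCentreBlockField` /
★ `PositiveInvolutionCentreBlockTransport`).

PURE ALGEBRA (no abelian varieties, no Hecke vocabulary).  Data: a commutative ring `K`, a `K`-module `V` with a
bilinear form `B : LinearMap.BilinForm K V` which is RIGHT-SEPARATING (`B.SeparatingRight`; consumers holding
`hB : B.Nondegenerate` pass `hB.2`); a type `D` of «endomorphisms» REALISED on `V` by an INJECTIVE map
`ρ : D → Module.End K V` (a bare function — for a bundled faithful `ρ : D →ₐ[ℚ] Module.End K V` pass `ρ` and its
injectivity verbatim); a self-map `ι : D → D` REALISED AS THE `B`-ADJOINT,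
`hadj : ∀ x, LinearMap.IsAdjointPair B B (ρ x) (ρ (ι x))`, i.e. `B (ρ x u) v = B u (ρ (ι x) v)`.

* §1 `apply_eq_of_isAdjointPair` — (∗) determines the adjoint: `IsAdjointPair B B (ρ s) (ρ s') ⟹ ι s = s'`;
  `apply_mem_of_forall_exists_isAdjointPair` / `image_subset_of_forall_isAdjointPair` — a set `S ⊆ D` each of
  whose members has a `B`-adjoint realised IN `S` (`∀ s ∈ S, ∃ s' ∈ S, IsAdjointPair B B (ρ s) (ρ s')`) is
  `ι`-stable, `ι '' S ⊆ S`.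
* §2 (`D` a `ℚ`-algebra, `ι : D →ₗ[ℚ] D` an anti-involution, ★ `AlbertTypes.IsAntiInvolution`)
  `IsAntiInvolution.apply_mem_adjoin_of_forall_exists_isAdjointPair` — then `ι (ℚ[S]) ⊆ ℚ[S]`
  (★ `IsAntiInvolution.apply_mem_adjoin_of_forall_mem`); and the packaged POSITIVE form
  `IsPositiveAntiInvolution.exists_stable_adjoin_of_forall_exists_isAdjointPair`:
  `∃ τ, IsPositiveAntiInvolution D τ ∧ ∀ x ∈ Algebra.adjoin ℚ S, τ x ∈ Algebra.adjoin ℚ S` — the shape of the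
  cell's «Rosati socket» («a positive anti-involution of `End⁰(A_K)` stabilising the Hecke image
  `ℚ[{T(KgK)}]`»), fed by `S = {T(KgK)}_g`, `s' = T(Kg⁻¹K)`.

Theorems only; no definition, no named fact, no instance, no `sorry`.  Count-neutral for the cell `hodgecm-mathlib`
(HC_CM is proved only modulo the 7 printed citations until rung 0 closes).

## References
* [KnusEtAl1998] M.-A. Knus, A. Merkurjev, M. Rost, J.-P. Tignol, *The Book of Involutions*, AMS Colloquium
  Publications 44 (1998), Ch. I, introduction, (∗) and the Theorem (pp. 1–2).
* [MumfordAV1970] D. Mumford, *Abelian Varieties* (1970), §20 (the Rosati involution as the `E^L`-adjoint) and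
  §21 Thm. 1 (positivity of the Rosati involution).
* [MilneCM2006] J. S. Milne, *Complex Multiplication* (2006/2020), Ch. I §1 Prop. 1.39 (proof, pp. 20–21).
-/

noncomputable section

namespace Literature.RingTheory.CentralSimple

open Function

universe u

variable {K : Type*} [CommRing K] {V : Type*} [AddCommGroup V] [Module K V]
variable {D : Type u}

/-! ## §1 The adjoint is unique; adjoint-closed sets are stable -/

/-- **(∗) determines the adjoint**: if `ι` is realised as the `B`-adjoint through the faithful `ρ`
(`B (ρ x u) v = B u (ρ (ι x) v)` for all `x`), `B` is right-separating, and `ρ s'` is SOME right `B`-adjoint of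
`ρ s`, then `ι s = s'`. [cite: KnusEtAl1998, Ch. I introduction (p. 1), (∗)]
[cite: KnusEtAl1998, Ch. I introduction, Theorem (p. 1)] -/
theorem apply_eq_of_isAdjointPair (B : LinearMap.BilinForm K V) (hB : B.SeparatingRight)
    (ρ : D → Module.End K V) (hρ : Injective ρ) (ι : D → D)
    (hadj : ∀ x : D, LinearMap.IsAdjointPair B B (ρ x) (ρ (ι x)))
    {s s' : D} (hs : LinearMap.IsAdjointPair B B (ρ s) (ρ s')) : ι s = s' := by
  apply hρ
  refine LinearMap.ext fun v => ?_
  refine sub_eq_zero.1 (hB _ fun u => ?_)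
  rw [map_sub, ← hadj s u v, ← hs u v, sub_self]

/-- **An adjoint-closed set is `ι`-stable** (membership form): if every `s ∈ S` has a right `B`-adjoint realised by
some `s' ∈ S`, then `ι s ∈ S` for `s ∈ S`. [cite: KnusEtAl1998, Ch. I introduction (p. 1), (∗)]
[cite: MumfordAV1970, §21 Thm. 1] -/
theorem apply_mem_of_forall_exists_isAdjointPair (B : LinearMap.BilinForm K V) (hB : B.SeparatingRight)
    (ρ : D → Module.End K V) (hρ : Injective ρ) (ι : D → D)
    (hadj : ∀ x : D, LinearMap.IsAdjointPair B B (ρ x) (ρ (ι x)))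
    {S : Set D} (hS : ∀ s ∈ S, ∃ s' ∈ S, LinearMap.IsAdjointPair B B (ρ s) (ρ s'))
    {s : D} (hs : s ∈ S) : ι s ∈ S := by
  obtain ⟨s', hs'S, hs'⟩ := hS s hs
  rwa [apply_eq_of_isAdjointPair B hB ρ hρ ι hadj hs']

/-- **An adjoint-closed set is `ι`-stable** (image form): `ι '' S ⊆ S`.
[cite: KnusEtAl1998, Ch. I introduction (p. 1), (∗)] [cite: MumfordAV1970, §21 Thm. 1] -/
theorem image_subset_of_forall_isAdjointPair (B : LinearMap.BilinForm K V) (hB : B.SeparatingRight)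
    (ρ : D → Module.End K V) (hρ : Injective ρ) (ι : D → D)
    (hadj : ∀ x : D, LinearMap.IsAdjointPair B B (ρ x) (ρ (ι x)))
    {S : Set D} (hS : ∀ s ∈ S, ∃ s' ∈ S, LinearMap.IsAdjointPair B B (ρ s) (ρ s')) :
    ι '' S ⊆ S := by
  rintro _ ⟨s, hs, rfl⟩
  exact apply_mem_of_forall_exists_isAdjointPair B hB ρ hρ ι hadj hS hs

/-! ## §2 Anti-involutions: the generated subalgebra is stable; the positive (Rosati-socket) form -/

/-- **An anti-involution realised as the `B`-adjoint stabilises `ℚ[S]` for an adjoint-closed `S`**: `D` a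
`ℚ`-algebra, `ι : D →ₗ[ℚ] D` an anti-involution (`(xy)' = y'x'`, `x'' = x`) with `B (ρ x u) v = B u (ρ x' v)`
through a faithful `ρ : D → End_K(V)`, `B` right-separating, and every `s ∈ S` with an adjoint realised in `S`;
then `x' ∈ ℚ[S]` for every `x ∈ ℚ[S] = Algebra.adjoin ℚ S` (★ `IsAntiInvolution.apply_mem_adjoin_of_forall_mem`).
[cite: MumfordAV1970, §21 Thm. 1] [cite: MilneCM2006, Ch. I §1 Prop. 1.39 (proof, p. 20–21)]
[cite: KnusEtAl1998, Ch. I introduction (p. 1), (∗)] -/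
theorem IsAntiInvolution.apply_mem_adjoin_of_forall_exists_isAdjointPair [Ring D] [Algebra ℚ D]
    {ι : D →ₗ[ℚ] D} (hι : IsAntiInvolution D ι)
    (B : LinearMap.BilinForm K V) (hB : B.SeparatingRight) (ρ : D → Module.End K V) (hρ : Injective ρ)
    (hadj : ∀ x : D, LinearMap.IsAdjointPair B B (ρ x) (ρ (ι x)))
    {S : Set D} (hS : ∀ s ∈ S, ∃ s' ∈ S, LinearMap.IsAdjointPair B B (ρ s) (ρ s'))
    {x : D} (hx : x ∈ Algebra.adjoin ℚ S) : ι x ∈ Algebra.adjoin ℚ S :=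
  hι.apply_mem_adjoin_of_forall_mem
    (fun _ hs => Algebra.subset_adjoin (apply_mem_of_forall_exists_isAdjointPair B hB ρ hρ ι hadj hS hs)) hx

/-- **The Rosati-socket form.**  A POSITIVE anti-involution `ι` of the `ℚ`-algebra `D` (`0 < Tr(x'x)`), realised
as the `B`-adjoint through a faithful `ρ : D → End_K(V)` for a right-separating `B`, together with a set `S` each
of whose members has a `B`-adjoint realised in `S`, yields «a positive anti-involution of `D` stabilising `ℚ[S]`»:
`∃ τ, IsPositiveAntiInvolution D τ ∧ ∀ x ∈ ℚ[S], τ x ∈ ℚ[S]` (namely `τ = ι`).  With `D = End⁰(A_K)`, `ι` the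
Rosati involution, `B` the Weil/Riemann form it is adjoint for, `S = {T(KgK)}` and `s' = T(Kg⁻¹K)`, this is the
Rosati-stability of the Hecke image (consumed by the instantiation `Liu2021/AppendixC/HeckeImageRosatiStable`).
[cite: MumfordAV1970, §21 Thm. 1] [cite: MilneCM2006, Ch. I §1 Prop. 1.39 (proof, p. 20–21)] -/
theorem IsPositiveAntiInvolution.exists_stable_adjoin_of_forall_exists_isAdjointPair [Ring D] [Algebra ℚ D]
    {ι : D →ₗ[ℚ] D} (hι : IsPositiveAntiInvolution D ι)
    (B : LinearMap.BilinForm K V) (hB : B.SeparatingRight) (ρ : D → Module.End K V) (hρ : Injective ρ)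
    (hadj : ∀ x : D, LinearMap.IsAdjointPair B B (ρ x) (ρ (ι x)))
    {S : Set D} (hS : ∀ s ∈ S, ∃ s' ∈ S, LinearMap.IsAdjointPair B B (ρ s) (ρ s')) :
    ∃ τ : D →ₗ[ℚ] D, IsPositiveAntiInvolution D τ ∧ ∀ x ∈ Algebra.adjoin ℚ S, τ x ∈ Algebra.adjoin ℚ S :=
  ⟨ι, hι, fun _ hx =>
    hι.toIsAntiInvolution.apply_mem_adjoin_of_forall_exists_isAdjointPair B hB ρ hρ hadj hS hx⟩

end Literature.RingTheory.CentralSimple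

end
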